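import Summits.QuantumFields.BalabanUV.Beta.GAN24.DirichletExhaustion

/-!
# `BalabanUV.Beta.GAN24.DirichletExhaustionSandwich` — binder row G-an2-4 / (CONV-C), part P2, PART 3: the SHORT-RANGE
# SANDWICH `CᵀΔC` in RATE form — B6 p. 250's sentence «C is a short-ranged operator, so C*Δ_kC has the same exponential decay
# as Δ_k», and its η-rate companion — OUR WORDING, NOT PRINTED: "`C*Δ_kC` inherits the one-step η-rate of `Δ_k`" —, with
# displayed constants (unit b2b-balaban-gan24-p2, gen 1, v1; v1.1 gen 10: docstring-only DOCFIX D1 of XREAD C-gan24leaf05-9)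

v1.1 (gen 10, DOCSTRING-ONLY; every declaration byte-identical to v1 p197116): XREAD C-gan24leaf05-9 (leaf-05-g16) DOCFIX D1 —
v1 printed the phrase "… the same η-RATE as Δ_k" inside quotation guillemets in this header and in the docstring of
`opClose_sandwich`; [Balaban1984PropagatorsII] p. 250 has NO η-rate sentence (its sentence is the exponential-DECAY one quoted
below, verbatim).  The η-rate companion is the author's RATE ANALOGUE of that sentence — our wording, asserted from no source,
proved here as `opClose_sandwich` / `opClose_sandwich_family`.  Both places now say so; nothing else changed.

HONEST FRAMING (cell contract, verbatim): «discharging `BetaPertH` makes Bałaban's UV stability UNCONDITIONAL — a real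
constructive-QFT result; it is NOT the continuum limit and NOT the Clay problem.»  This file is item (I4) of the
instantiation census of PART 2 (`GAN24/DirichletExhaustionFamily.lean`): the operator η-rate of the tree (for Bałaban's `Δ_k`
at `U = 1`: `T4Rate166StripDirect.latticeKernel_Gsym_rate2`, `θ = L⁻²`) must be carried from `Δ_k` to the unit-lattice
operator `A_k = C*Δ_kC` of [Balaban1984PropagatorsII] (2.156)–(2.157) before PART 1/2 (`limInv_sub_limInv_rate`,
`convC_limInv`, `dirichletExhaustion_rate`) apply; here `C` is ANY fixed exponentially bounded kernel (a finite-range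
elimination matrix is one).  [folklore] real analysis (absolutely convergent double sums on `ℤ^d × Fin N`); it formalises
no printed statement, cites none as a hypothesis, instantiates nothing of Bałaban's; NOT `BetaPertH`, NOT continuum, NOT Clay.

ABSOLUTE RULE (cell, verbatim): «No internally-minted statement may enter as a cited fact. Every hypothesis is either
kernel-proved in this package or a verbatim quotation of a PUBLISHED theorem with page reference. The manuscript(s) under
audit are NOT citable for their own disputed steps — they are the thing under adjudication; programme-internal
(2001/route/tribunal) claims are never citable.»

PRINTED LOCATION (not a hypothesis): [Balaban1984PropagatorsII] = T. Bałaban, Commun. Math. Phys. **96** (1984) 223–250,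
p. 250: *«C is a short-ranged operator, so C*Δ_kC has the same exponential decay as Δ_k.»* (render
`b2b-balaban-ref1/pages/1984-cmp96-propagators-rt-II/…-p028-x2.png`, quotation as certified in `B4Sect5Torus` / `T4Cov2156Rate`).

## What this file proves (0 sorry; imports PART 1 only)

* `sandwich C Δ p q := Σ'_{(r,s)} C(r,p)·Δ(r,s)·C(s,q)` — the kernel `(CᵀΔC)(p,q)` as ONE absolutely convergent sum over
  `(ℤ^d × Fin N)²`; `summable_sandwich`; `sandwich_sub` (linearity in `Δ`); `sandwich_symm` (symmetric `Δ` ⟹ symmetric `CᵀΔC`).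
* **`abs_sandwich_le`** (the core estimate): `|C| ≤ c_C e^{−δ|·|}`, `|Δ| ≤ ε e^{−δ|·|}` ⟹
  `|CᵀΔC|(p,q) ≤ c_C²·(N·K_d(δ/2))²·ε·e^{−(δ/2)|p−q|}` (the chain `p → r → s → q`, `B4Sect5Exhaustion.sum_expKernel2_le`).
* **`sandwich_decay`** (B6 p. 250's sentence, quantitative) and **`opClose_sandwich`** (its RATE companion):
  `OpClose ℤ^d Δ Δ′ ε δ` ⟹ `OpClose ℤ^d (CᵀΔC) (CᵀΔ′C) (sandwichConst·ε) (δ/2)`, `sandwichConst = c_C²(N·K_d(δ/2))²`;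
  `opClose_sandwich_family`: a geometric operator step-rate `θ₀θ^k` of `k ↦ Δ_k` gives the step-rate `sandwichConst·θ₀·θ^k`
  of `k ↦ CᵀΔ_kC` — the `step` field of PART 1's `OpFamilyRate` for the sandwiched family (its `hyp56` field, the
  `k`-uniform coercivity (2.157), is NOT generic and is NOT transferred here: it is the supplier's (I2)).
NOT CLAIMED: coercivity of `CᵀΔC`; anything about Bałaban's actual `C`, `Δ_k`; NOT summit progress.
-/

namespace Summit.QuantumFields.BalabanUV.Beta.GAN24.DirichletExhaustionSandwich

open Finset Real Filter Topology
open Literature.MathematicalPhysics.QuantumFieldTheory.Balaban1983to89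
open B4Sect5Proof (latticeConst latticeConst_nonneg)
open B4Sect5Exhaustion (K sum_expKernel2_le)
open Summit.QuantumFields.BalabanUV.Beta.GAN24.DirichletExhaustion

noncomputable section

variable {d N : ℕ}

/-! ## §1 The sandwich kernel `CᵀΔC` as one absolutely convergent sum over pairs -/

/-- The kernel `(CᵀΔC)(p,q) = Σ_{r,s} C(r,p)·Δ(r,s)·C(s,q)`, as a `tsum` over pairs `(r,s)`. -/
def sandwich (C Δ : K d N → K d N → ℝ) : K d N → K d N → ℝ :=
  fun p q => ∑' x : K d N × K d N, C x.1 p * Δ x.1 x.2 * C x.2 q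

/-- The sandwich constant `c_C²·(N·K_d(δ/2))²`. -/
def sandwichConst (d N : ℕ) (cC δ : ℝ) : ℝ := cC * cC * ((N * latticeConst d (δ / 2)) * (N * latticeConst d (δ / 2)))

/-- `sandwichConst ≥ 0`. -/
theorem sandwichConst_nonneg (d N : ℕ) (cC : ℝ) {δ : ℝ} (hδ : 0 < δ) : 0 ≤ sandwichConst d N cC δ := by
  unfold sandwichConst
  have := latticeConst_nonneg d (half_pos hδ).le
  have : 0 ≤ cC * cC := mul_self_nonneg cC
  positivity

section Core

variable {C Δ : K d N → K d N → ℝ} {cC ε δ : ℝ}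

/-- The chain bookkeeping `p → r → s → q`: with all three factors decaying at rate `δ`,
`e^{−δ|r−p|}e^{−δ|r−s|}e^{−δ|s−q|} ≤ e^{−(δ/2)|p−q|}·e^{−(δ/2)|r−s|}·e^{−(δ/2)|p−r|}`. -/
theorem exp_chain_le (hδ : 0 ≤ δ) (p q r s : Fin d → ℤ) :
    Real.exp (-(δ * dist r p)) * Real.exp (-(δ * dist r s)) * Real.exp (-(δ * dist s q)) ≤
      Real.exp (-(δ / 2 * dist p q)) * (Real.exp (-(δ / 2 * dist r s)) * Real.exp (-(δ / 2 * dist p r))) := by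
  rw [← Real.exp_add, ← Real.exp_add, ← Real.exp_add, ← Real.exp_add]
  apply Real.exp_le_exp.mpr
  have h1 : dist p q ≤ dist p r + dist r s + dist s q := by
    have := dist_triangle p r q
    have := dist_triangle r s q
    linarith
  have h2 : dist r p = dist p r := dist_comm _ _
  have h3 : 0 ≤ dist p r := dist_nonneg
  have h4 : 0 ≤ dist r s := dist_nonneg
  have h5 : 0 ≤ dist s q := dist_nonneg
  rw [h2]
  nlinarith [mul_nonneg hδ h3, mul_nonneg hδ h4, mul_nonneg hδ h5, mul_le_mul_of_nonneg_left h1 hδ]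

/-- The summable majorant of the sandwich summand and its total. -/
theorem summable_majorant (hδ : 0 < δ) (W : ℝ) (p : K d N) :
    Summable (fun x : K d N × K d N =>
      W * (Real.exp (-(δ / 2 * dist x.1.1 x.2.1)) * Real.exp (-(δ / 2 * dist p.1 x.1.1)))) ∧
    ∑' x : K d N × K d N, W * (Real.exp (-(δ / 2 * dist x.1.1 x.2.1)) * Real.exp (-(δ / 2 * dist p.1 x.1.1))) ≤
      |W| * ((N * latticeConst d (δ / 2)) * (N * latticeConst d (δ / 2))) := by
  classical
  have hδ2 : 0 < δ / 2 := half_pos hδ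
  -- the swapped majorant matches `sum_expKernel2_le`
  have hbound : ∀ S : Finset (K d N × K d N),
      ∑ x ∈ S, Real.exp (-(δ / 2 * dist x.1.1 x.2.1)) * Real.exp (-(δ / 2 * dist p.1 x.1.1)) ≤
        (N * latticeConst d (δ / 2)) * (N * latticeConst d (δ / 2)) := by
    intro S
    have h := sum_expKernel2_le (N := N) hδ2 hδ2 p.1 (S.map (Equiv.prodComm _ _).toEmbedding)
    rw [Finset.sum_map] at h
    refine (le_of_eq ?_).trans h
    refine Finset.sum_congr rfl fun x _ => ?_
    simp only [Equiv.coe_toEmbedding, Equiv.prodComm_apply, Prod.fst_swap, Prod.snd_swap]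
    rw [dist_comm x.2.1 x.1.1]
  have hnn : ∀ x : K d N × K d N,
      0 ≤ Real.exp (-(δ / 2 * dist x.1.1 x.2.1)) * Real.exp (-(δ / 2 * dist p.1 x.1.1)) := fun x => by positivity
  have hs : Summable fun x : K d N × K d N =>
      Real.exp (-(δ / 2 * dist x.1.1 x.2.1)) * Real.exp (-(δ / 2 * dist p.1 x.1.1)) :=
    summable_of_sum_le hnn hbound
  refine ⟨hs.mul_left W, ?_⟩
  rw [tsum_mul_left]
  have ht : ∑' x : K d N × K d N, Real.exp (-(δ / 2 * dist x.1.1 x.2.1)) * Real.exp (-(δ / 2 * dist p.1 x.1.1)) ≤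
      (N * latticeConst d (δ / 2)) * (N * latticeConst d (δ / 2)) := hs.tsum_le_of_sum_le hbound
  have ht0 : 0 ≤ ∑' x : K d N × K d N,
      Real.exp (-(δ / 2 * dist x.1.1 x.2.1)) * Real.exp (-(δ / 2 * dist p.1 x.1.1)) := tsum_nonneg hnn
  calc W * ∑' x : K d N × K d N, Real.exp (-(δ / 2 * dist x.1.1 x.2.1)) * Real.exp (-(δ / 2 * dist p.1 x.1.1))
      ≤ |W| * ∑' x : K d N × K d N,
          Real.exp (-(δ / 2 * dist x.1.1 x.2.1)) * Real.exp (-(δ / 2 * dist p.1 x.1.1)) :=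
        mul_le_mul_of_nonneg_right (le_abs_self W) ht0
    _ ≤ |W| * ((N * latticeConst d (δ / 2)) * (N * latticeConst d (δ / 2))) :=
        mul_le_mul_of_nonneg_left ht (abs_nonneg W)

/-- Termwise domination of the sandwich summand by the majorant with `W = c_C·ε·c_C·e^{−(δ/2)|p−q|}`. -/
theorem abs_term_le (hδ : 0 < δ) (hcC : 0 ≤ cC) (hC : ∀ r p : K d N, |C r p| ≤ cC * Real.exp (-(δ * dist r.1 p.1)))
    (hΔ : ∀ r s : K d N, |Δ r s| ≤ ε * Real.exp (-(δ * dist r.1 s.1))) (p q : K d N) (x : K d N × K d N) :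
    ‖C x.1 p * Δ x.1 x.2 * C x.2 q‖ ≤
      cC * ε * cC * Real.exp (-(δ / 2 * dist p.1 q.1)) *
        (Real.exp (-(δ / 2 * dist x.1.1 x.2.1)) * Real.exp (-(δ / 2 * dist p.1 x.1.1))) := by
  have hε : 0 ≤ ε := by
    have h := hΔ p p
    rw [dist_self, mul_zero, neg_zero, Real.exp_zero, mul_one] at h
    exact (abs_nonneg _).trans h
  rw [Real.norm_eq_abs, abs_mul, abs_mul]
  have h1 := hC x.1 p
  have h2 := hΔ x.1 x.2
  have h3 := hC x.2 q
  have hchain := exp_chain_le hδ.le p.1 q.1 x.1.1 x.2.1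
  calc |C x.1 p| * |Δ x.1 x.2| * |C x.2 q|
      ≤ cC * Real.exp (-(δ * dist x.1.1 p.1)) * (ε * Real.exp (-(δ * dist x.1.1 x.2.1))) *
          (cC * Real.exp (-(δ * dist x.2.1 q.1))) := by
        apply mul_le_mul (mul_le_mul h1 h2 (abs_nonneg _) (by positivity)) h3 (abs_nonneg _)
        positivity
    _ = cC * ε * cC * (Real.exp (-(δ * dist x.1.1 p.1)) * Real.exp (-(δ * dist x.1.1 x.2.1)) *
          Real.exp (-(δ * dist x.2.1 q.1))) := by ring
    _ ≤ cC * ε * cC * (Real.exp (-(δ / 2 * dist p.1 q.1)) *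
          (Real.exp (-(δ / 2 * dist x.1.1 x.2.1)) * Real.exp (-(δ / 2 * dist p.1 x.1.1)))) :=
        mul_le_mul_of_nonneg_left hchain (by positivity)
    _ = _ := by ring

/-- **The sandwich summand is absolutely summable** under exponential bounds on `C` and `Δ`. -/
theorem summable_sandwich (hδ : 0 < δ) (hcC : 0 ≤ cC)
    (hC : ∀ r p : K d N, |C r p| ≤ cC * Real.exp (-(δ * dist r.1 p.1)))
    (hΔ : ∀ r s : K d N, |Δ r s| ≤ ε * Real.exp (-(δ * dist r.1 s.1))) (p q : K d N) :
    Summable fun x : K d N × K d N => C x.1 p * Δ x.1 x.2 * C x.2 q :=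
  (summable_majorant hδ _ p).1.of_norm_bounded (abs_term_le hδ hcC hC hΔ p q)

/-- **THE CORE ESTIMATE**: `|C(r,p)| ≤ c_C e^{−δ|r−p|}` and `|Δ(r,s)| ≤ ε e^{−δ|r−s|}` give
`|(CᵀΔC)(p,q)| ≤ c_C²·(N·K_d(δ/2))²·ε·e^{−(δ/2)|p−q|} = sandwichConst·ε·e^{−(δ/2)|p−q|}`. -/
theorem abs_sandwich_le (hδ : 0 < δ) (hcC : 0 ≤ cC)
    (hC : ∀ r p : K d N, |C r p| ≤ cC * Real.exp (-(δ * dist r.1 p.1)))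
    (hΔ : ∀ r s : K d N, |Δ r s| ≤ ε * Real.exp (-(δ * dist r.1 s.1))) (p q : K d N) :
    |sandwich C Δ p q| ≤ sandwichConst d N cC δ * ε * Real.exp (-(δ / 2 * dist p.1 q.1)) := by
  have hε : 0 ≤ ε := by
    have h := hΔ p p
    rw [dist_self, mul_zero, neg_zero, Real.exp_zero, mul_one] at h
    exact (abs_nonneg _).trans h
  obtain ⟨hsum, htot⟩ := summable_majorant (N := N) hδ (cC * ε * cC * Real.exp (-(δ / 2 * dist p.1 q.1))) p
  have h := tsum_of_norm_bounded hsum.hasSum (abs_term_le hδ hcC hC hΔ p q)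
  rw [Real.norm_eq_abs] at h
  refine h.trans (htot.trans (le_of_eq ?_))
  rw [abs_of_nonneg (by positivity)]
  unfold sandwichConst; ring

end Core

/-! ## §2 Linearity and symmetry -/

section Algebra

variable {C Δ Δ' : K d N → K d N → ℝ} {cC c c' δ : ℝ}

/-- Linearity in the middle slot (under absolute convergence): `CᵀΔ′C − CᵀΔC = Cᵀ(Δ′ − Δ)C`. -/
theorem sandwich_sub (hδ : 0 < δ) (hcC : 0 ≤ cC)
    (hC : ∀ r p : K d N, |C r p| ≤ cC * Real.exp (-(δ * dist r.1 p.1)))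
    (hΔ : ∀ r s : K d N, |Δ r s| ≤ c * Real.exp (-(δ * dist r.1 s.1)))
    (hΔ' : ∀ r s : K d N, |Δ' r s| ≤ c' * Real.exp (-(δ * dist r.1 s.1))) (p q : K d N) :
    sandwich C Δ' p q - sandwich C Δ p q = sandwich C (Δ' - Δ) p q := by
  unfold sandwich
  rw [← (summable_sandwich hδ hcC hC hΔ' p q).tsum_sub (summable_sandwich hδ hcC hC hΔ p q)]
  refine tsum_congr fun x => ?_
  simp only [Pi.sub_apply]; ring

/-- A symmetric middle kernel gives a symmetric sandwich: `(CᵀΔC)(p,q) = (CᵀΔC)(q,p)` (re-indexing `(r,s) ↦ (s,r)`). -/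
theorem sandwich_symm (hsymm : ∀ r s : K d N, Δ r s = Δ s r) (p q : K d N) :
    sandwich C Δ p q = sandwich C Δ q p := by
  unfold sandwich
  rw [← (Equiv.prodComm (K d N) (K d N)).tsum_eq (fun x : K d N × K d N => C x.1 q * Δ x.1 x.2 * C x.2 p)]
  refine tsum_congr fun x => ?_
  simp only [Equiv.prodComm_apply, Prod.fst_swap, Prod.snd_swap]
  rw [hsymm x.2 x.1]; ring

end Algebra

/-! ## §3 B6 p. 250's sentence, quantitative, and its RATE companion -/

section Rate

variable {C Δ Δ' : K d N → K d N → ℝ} {cC c₀ ε δ : ℝ}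

/-- **«C is a short-ranged operator, so C*Δ_kC has the same exponential decay as Δ_k»** ([Balaban1984PropagatorsII] p. 250),
quantitative: `|Δ| ≤ c₀e^{−δ|·|}` and `|C| ≤ c_C e^{−δ|·|}` give `|CᵀΔC|(p,q) ≤ sandwichConst·c₀·e^{−(δ/2)|p−q|}`. -/
theorem sandwich_decay (hδ : 0 < δ) (hcC : 0 ≤ cC)
    (hC : ∀ r p : K d N, |C r p| ≤ cC * Real.exp (-(δ * dist r.1 p.1)))
    (hΔ : ∀ r s : K d N, |Δ r s| ≤ c₀ * Real.exp (-(δ * dist r.1 s.1))) (p q : K d N) :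
    |sandwich C Δ p q| ≤ sandwichConst d N cC δ * c₀ * Real.exp (-(δ / 2 * dist p.1 q.1)) :=
  abs_sandwich_le hδ hcC hC hΔ p q

/-- **THE RATE COMPANION** (OUR rate analogue of p. 250's decay sentence — not a printed statement; wording ours: "`C*Δ_kC`
inherits the one-step η-rate of `Δ_k`"): operator closeness `OpClose ℤ^d Δ Δ′ ε δ` of two decaying middle kernels passes to the
sandwiches, `OpClose ℤ^d (CᵀΔC) (CᵀΔ′C) (sandwichConst·ε) (δ/2)`. -/
theorem opClose_sandwich (hδ : 0 < δ) (hcC : 0 ≤ cC)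
    (hC : ∀ r p : K d N, |C r p| ≤ cC * Real.exp (-(δ * dist r.1 p.1)))
    (hΔ : ∀ r s : K d N, |Δ r s| ≤ c₀ * Real.exp (-(δ * dist r.1 s.1)))
    (hΔ' : ∀ r s : K d N, |Δ' r s| ≤ c₀ * Real.exp (-(δ * dist r.1 s.1)))
    (hclose : OpClose (Set.univ : Set (Fin d → ℤ)) Δ Δ' ε δ) :
    OpClose (Set.univ : Set (Fin d → ℤ)) (sandwich C Δ) (sandwich C Δ') (sandwichConst d N cC δ * ε) (δ / 2) := by
  intro p q _ _
  rw [sandwich_sub hδ hcC hC hΔ hΔ' p q]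
  exact abs_sandwich_le hδ hcC hC (fun r s => hclose r s (Set.mem_univ _) (Set.mem_univ _)) p q

/-- **Family form** (the `step` field of PART 1's `OpFamilyRate` for the sandwiched family): a geometric operator step-rate
`θ₀θ^k` of `k ↦ Δ_k` (all decaying with `(c₀, δ)`) gives the step-rate `sandwichConst·θ₀·θ^k` of `k ↦ CᵀΔ_kC` at rate `δ/2`. -/
theorem opClose_sandwich_family (hδ : 0 < δ) (hcC : 0 ≤ cC) {Δf : ℕ → K d N → K d N → ℝ} {θ₀ θ : ℝ}
    (hC : ∀ r p : K d N, |C r p| ≤ cC * Real.exp (-(δ * dist r.1 p.1)))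
    (hΔ : ∀ k (r s : K d N), |Δf k r s| ≤ c₀ * Real.exp (-(δ * dist r.1 s.1)))
    (hstep : ∀ k, OpClose (Set.univ : Set (Fin d → ℤ)) (Δf k) (Δf (k + 1)) (θ₀ * θ ^ k) δ) (k : ℕ) :
    OpClose (Set.univ : Set (Fin d → ℤ)) (sandwich C (Δf k)) (sandwich C (Δf (k + 1)))
      (sandwichConst d N cC δ * θ₀ * θ ^ k) (δ / 2) := by
  rw [mul_assoc]
  exact opClose_sandwich hδ hcC hC (hΔ k) (hΔ (k + 1)) (hstep k)

end Rate

end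

end Summit.QuantumFields.BalabanUV.Beta.GAN24.DirichletExhaustionSandwich
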